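import Summits.ValiantsHypothesis.ValiantsHypothesis.Theorems.LacunarySymmetroidMatrixDescartesFiniteSectorSumMasksHigherSix

/-!
# `MatrixDescartes` — line «stamp»: `n(15,4) = 1383` finite core, SLICES (8) of the kernel enumeration (part F)

HONEST FRAMING.  Object-search cell `pub-symmetroid`, seat val-sym-door-p5 g10 (generators of val-sym-door-p5 g8/g9 VERBATIM, m-tables extended to m ≤ 19; fold binders typed `(x acc : ℕ)` — same elaborated terms, fast elaboration).  HELPER of the crux item `stmt-ValiantsHypothesis-18050` with NO closure claim and no
statement about pencils: SLICES (third and fourth values fixed) of the pruned nested enumeration behind `StampLawAt 15 5 1383` (assembled with the T3 transfer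
in `…FiniteSectorStampCeilingFifteenFive`), decided in the kernel with `15`-fold sums as iterated shift-form bitmasks.  The whole enumeration has 136797 live prefixes.
Nothing here bears on the crux, the doors, or `VP ≠ VNP`.
[folklore] Finite enumeration (postage-stamp numbers `n(15,·)`); no citation is load-bearing.
-/

-- `Summit.ValiantsHypothesis.ValiantsHypothesis.…` repeats a component by the D-0017 layout
-- (single-conjunct summit), which the `dupNamespace` linter flags; the name is mandated.
set_option linter.dupNamespace false

namespace Summit.ValiantsHypothesis.ValiantsHypothesis.Theorems.LacunarySymmetroidMatrixDescartes.FiniteSector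

set_option synthInstance.maxSize 2000000 in
set_option synthInstance.maxHeartbeats 2000000 in
set_option maxHeartbeats 4000000 in
/-- **Finite core of `n(15,4) = 1383`, slice `(a = 8)`** (12448 live prefixes; pruned nested enumeration over the remaining sorted values
`< 1386`, `15`-fold sums as shift-form bitmasks, `decide` in the kernel): prefixes covering `[0, next)` never cover `[0, 1384]`. [folklore] -/
theorem stampCheck_fifteen_five_s8 :
    ∀ b ∈ List.range 1386, (8 < b ∧ (List.foldr (fun (x acc : ℕ) => acc ||| (List.foldr (fun (x acc : ℕ) => acc ||| (List.foldr (fun (x acc : ℕ) => acc ||| (List.foldr (fun (x acc : ℕ) => acc ||| (List.foldr (fun (x acc : ℕ) => acc ||| (List.foldr (fun (x acc : ℕ) => acc ||| (List.foldr (fun (x acc : ℕ) => acc ||| (List.foldr (fun (x acc : ℕ) => acc ||| (List.foldr (fun (x acc : ℕ) => acc ||| (List.foldr (fun (x acc : ℕ) => acc ||| (List.foldr (fun (x acc : ℕ) => acc ||| (List.foldr (fun (x acc : ℕ) => acc ||| (List.foldr (fun (x acc : ℕ) => acc ||| (List.foldr (fun (x acc : ℕ) => acc ||| (List.foldr (fun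 (y acc : ℕ) => acc ||| 2 ^ y) 0 [0, 1, 8]) * 2 ^ x) 0 [0, 1, 8]) * 2 ^ x) 0 [0, 1, 8]) * 2 ^ x) 0 [0, 1, 8]) * 2 ^ x) 0 [0, 1, 8]) * 2 ^ x) 0 [0, 1, 8]) * 2 ^ x) 0 [0, 1, 8]) * 2 ^ x) 0 [0, 1, 8]) * 2 ^ x) 0 [0, 1, 8]) * 2 ^ x) 0 [0, 1, 8]) * 2 ^ x) 0 [0, 1, 8]) * 2 ^ x) 0 [0, 1, 8]) * 2 ^ x) 0 [0, 1, 8]) * 2 ^ x) 0 [0, 1, 8]) * 2 ^ x) 0 [0, 1, 8] % 2 ^ (min 1385 b) = 2 ^ (min 1385 b) - 1)) →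
    ∀ c ∈ List.range 1386, (b < c ∧ (List.foldr (fun (x acc : ℕ) => acc ||| (List.foldr (fun (x acc : ℕ) => acc ||| (List.foldr (fun (x acc : ℕ) => acc ||| (List.foldr (fun (x acc : ℕ) => acc ||| (List.foldr (fun (x acc : ℕ) => acc ||| (List.foldr (fun (x acc : ℕ) => acc ||| (List.foldr (fun (x acc : ℕ) => acc ||| (List.foldr (fun (x acc : ℕ) => acc ||| (List.foldr (fun (x acc : ℕ) => acc ||| (List.foldr (fun (x acc : ℕ) => acc ||| (List.foldr (fun (x acc : ℕ) => acc ||| (List.foldr (fun (x acc : ℕ) => acc ||| (List.foldr (fun (x acc : ℕ) => acc ||| (List.foldr (fun (x acc : ℕ) => acc ||| (List.foldr (fun (y acc : ℕ) => acc ||| 2 ^ y) 0 [0, 1, 8, b]) * 2 ^ x) 0 [0, 1, 8, b]) * 2 ^ x) 0 [0, 1, 8, b]) * 2 ^ x) 0 [0, 1, 8, b]) * 2 ^ x) 0 [0, 1, 8, b]) * 2 ^ x) 0 [0, 1, 8, b]) * 2 ^ x) 0 [0, 1, 8, b]) * 2 ^ x) 0 [0, 1, 8, b]) * 2 ^ x)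 0 [0, 1, 8, b]) * 2 ^ x) 0 [0, 1, 8, b]) * 2 ^ x) 0 [0, 1, 8, b]) * 2 ^ x) 0 [0, 1, 8, b]) * 2 ^ x) 0 [0, 1, 8, b]) * 2 ^ x) 0 [0, 1, 8, b]) * 2 ^ x) 0 [0, 1, 8, b] % 2 ^ (min 1385 c) = 2 ^ (min 1385 c) - 1)) →
    ¬ (List.foldr (fun (x acc : ℕ) => acc ||| (List.foldr (fun (x acc : ℕ) => acc ||| (List.foldr (fun (x acc : ℕ) => acc ||| (List.foldr (fun (x acc : ℕ) => acc ||| (List.foldr (fun (x acc : ℕ) => acc ||| (List.foldr (fun (x acc : ℕ) => acc ||| (List.foldr (fun (x acc : ℕ) => acc ||| (List.foldr (fun (x acc : ℕ) => acc ||| (List.foldr (fun (x acc : ℕ) => acc ||| (List.foldr (fun (x acc : ℕ) => acc ||| (List.foldr (fun (x acc : ℕ) => acc ||| (List.foldr (fun (x acc : ℕ) => acc ||| (List.foldr (fun (x acc : ℕ) => acc ||| (List.foldr (fun (x acc : ℕ) => acc ||| (List.foldr (fun (y acc : ℕ) => acc ||| 2 ^ y) 0 [0, 1, 8, b, c]) *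 2 ^ x) 0 [0, 1, 8, b, c]) * 2 ^ x) 0 [0, 1, 8, b, c]) * 2 ^ x) 0 [0, 1, 8, b, c]) * 2 ^ x) 0 [0, 1, 8, b, c]) * 2 ^ x) 0 [0, 1, 8, b, c]) * 2 ^ x) 0 [0, 1, 8, b, c]) * 2 ^ x) 0 [0, 1, 8, b, c]) * 2 ^ x) 0 [0, 1, 8, b, c]) * 2 ^ x) 0 [0, 1, 8, b, c]) * 2 ^ x) 0 [0, 1, 8, b, c]) * 2 ^ x) 0 [0, 1, 8, b, c]) * 2 ^ x) 0 [0, 1, 8, b, c]) * 2 ^ x) 0 [0, 1, 8, b, c]) * 2 ^ x) 0 [0, 1, 8, b, c] % 2 ^ 1385 = 2 ^ 1385 - 1) := by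
  decide +kernel

end Summit.ValiantsHypothesis.ValiantsHypothesis.Theorems.LacunarySymmetroidMatrixDescartes.FiniteSector
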